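import Summits.BirchSwinnertonDyer.BirchSwinnertonDyer.Theses.GenusKolyvaginAtTwo
import Summits.BirchSwinnertonDyer.BirchSwinnertonDyer.Theorems.ByReductionTypeAtTwoRankOneAtTwoOffBigImageOddLocalEngineEndToEnd
import HarnessLib

/-!
# GK2 · Q4_T `KolyvaginExactAtTwoPosDiscT` (stmt-BirchSwinnertonDyer-23240) — the regular-Frobenius Kolyvagin
# supply at `2`, PROVED (helper `--supports stmt-BirchSwinnertonDyer-23240`; director-bsd g15 2026-08-28T20:03:35Z,
# critic idea-crit-5 V#142/V#160)

Pen `bsd-idea-1` g10.  This file lands the LEVER of LINE 16_T (`HOME/line16T/regular_frobenius_T.lean`, registered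
skeleton on 23240) as a tree theorem: `regularKolyvaginSupplyAtTwo_proof` (type = the body of LINE 16_T's `RegularKolyvaginSupplyAtTwo`) — beyond
every bound an inert Kolyvagin prime `ℓ` whose Frobenius acts on `E[2^{n+1}]` as a REGULAR involution `h`
(`(1+h)E[2^{n+1}] ≅ ℤ/2^{n+1}`, lossless), with `2^{n+1} ∣ ℓ+1`, `2^{n+1} ∣ a_ℓ` and McCallum's EXACT local orders
`ord c_{i,λ} = 2^{Nv i}` for any `c`-stable independent family — the sibling crux 23716's end-to-end engine
`OffBigImageOddLocalAtTwo.Engine.exists_regular_kolyvaginPrime_of_heegner` with its Čebotarev token discharged by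
`Automorphic.chebotarev_artinRep_of_galoisSide`, packaged in the GK2 frame (`∀ n > 0, ρ_{E,2^n}` onto, `N = N_E`).
On `Δ > 0` these primes replace the lossy `c₀`-primes (`(1+c₀)E[2^M] ≅ 2ℤ/2^M`).  THEOREM-ONLY (no `def : Prop`, so nothing is relocated to Literature): the type is the verbatim body of the
skeleton's `def RegularKolyvaginSupplyAtTwo`, so the forthcoming split child of Q4_T with this text closes by
`exact regularKolyvaginSupplyAtTwo_proof`. [topic NumberTheory/EllipticCurves]

Nothing here proves Q4_T, `Rank1Residual.NonCMAtTwo`, BSD or the summit.  BSD is not proved.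
-/

set_option linter.dupNamespace false
set_option autoImplicit false

noncomputable section

namespace Summit.BirchSwinnertonDyer.BirchSwinnertonDyer.Theorems.GenusRegularSupply

open scoped Classical
open WeierstrassCurve NumberField IsDedekindDomain Field
open Literature.NumberTheory.GaloisRepresentations Literature.NumberTheory.EllipticCurves
open Literature.NumberTheory
open Rat.HeightOneSpectrum
open Summit.BirchSwinnertonDyer.BirchSwinnertonDyer.Theses.GenusKolyvaginAtTwo
open Summit.BirchSwinnertonDyer.BirchSwinnertonDyer.Theorems


/-- **Regular Kolyvagin supply at `2` (GK2 frame, sign-free).**  `E/ℚ` globally minimal, `K` imaginary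
quadratic with `d_K` odd and the Heegner hypothesis for `N_E`, `ρ_{E,2^n}` onto for all `n > 0`, `c₀` a
complex conjugation, `c ≠ 1` in `Gal(K/ℚ)`; a `c`-stable (under the involution `π`) family of classes
`cs i ∈ H¹(K, E[2^{n+1}])` of exact orders `2^{e i}`, independent (`hind`) and detected on `Γ_{K(E[2^{n+1}])}`
(`hres`); targets `Nv i ≤ e i`, `π`-symmetric.  THEN there is `ρ ∈ Γ_K` with `h := c₀ · res ρ` an
involution on `E[2^{n+1}]` inverting `μ_{2^{n+1}}`, REGULAR (`2^n (P + hP) ≠ 0` for some `P`: `(1+h)` has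
full order) and LOSSLESS (`h`-fixed `2^k`-torsion = `(1+h)` of `2^k`-torsion), and beyond every bound a
prime `ℓ ∤ 2 N_E d_K`, inert in `K`, with an arithmetic Frobenius acting on `E[2^{n+1}]` as `h` and on `K`
as `c₀`, `2^{n+1} ∣ ℓ + 1`, `2^{n+1} ∣ a_ℓ`, and `ord c_{i,λ} = 2^{Nv i}` EXACTLY at `λ ∋ ℓ`.
(= `Engine.exists_regular_kolyvaginPrime_of_heegner` with its Čebotarev token discharged.)
[cite: GrossLMS1991, §3 (3.1)–(3.3), §9 Prop. 9.3] [cite: McCallumLMS1991, §3 Cor. 3.2]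

PROOF: the sibling crux 23716's landed end-to-end engine port `Engine.exists_regular_kolyvaginPrime_of_heegner`, with its only token `Automorphic.chebotarev_artinRep` discharged by the tree theorem `Automorphic.chebotarev_artinRep_of_galoisSide`, and `N := N_E`.  No sorry.  THEOREM-ONLY file (no `def`, no named fact): the statement below is the verbatim body of `def RegularKolyvaginSupplyAtTwo` of the registered skeleton HOME/line16T/regular_frobenius_T.lean. -/
theorem regularKolyvaginSupplyAtTwo_proof :
    ∀ (W : WeierstrassCurve ℚ) [W.IsElliptic] [W.IsGloballyMinimal] [NeZero (W.conductorNorm ℤ)]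
      (K : Type) [Field K] [NumberField K], IsImaginaryQuadratic K → Odd (NumberField.discr K) →
      SatisfiesHeegnerHypothesis (W.conductorNorm ℤ) K →
      (∀ n : ℕ, 0 < n → W.HasSurjectiveModNGaloisRep ((2 : ℤ) ^ n)) →
      ∀ (n : ℕ) (c₀ : absoluteGaloisGroup ℚ), IsComplexConjugation (Rat.castHom ℝ) c₀ →
      ∀ (c : K ≃ₐ[ℚ] K), c ≠ 1 →
      ∀ (r : ℕ) (cs : Fin r → galH1Torsion (W.baseChange K) ((2 ^ (n + 1) : ℕ) : ℤ)) (π : Fin r → Fin r),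
      (∀ i, π (π i) = i) → (∀ i, conjAct W c ((2 ^ (n + 1) : ℕ) : ℤ) (cs i) = cs (π i)) →
      ∀ (e : Fin r → ℕ), (∀ i, ((2 : ℤ) ^ e i) • cs i = 0) →
      (∀ a : Fin r → ℤ, ∑ i, a i • cs i = 0 → ∀ i, ((2 : ℤ) ^ e i) ∣ a i) →
      (∀ a : Fin r → ℤ, (∀ ρ ∈ torsionFixing (W.baseChange K) ((2 ^ (n + 1) : ℕ) : ℤ),
        h1Eval (W.baseChange K) ((2 ^ (n + 1) : ℕ) : ℤ) (∑ i, a i • cs i) ρ = 0) → ∑ i, a i • cs i = 0) →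
      ∀ (Nv : Fin r → ℕ), (∀ i, Nv i ≤ e i) → (∀ i, e i ≤ n + 1) → (∀ i, Nv (π i) = Nv i) →
      ∀ (b : ℕ),
      ∃ ρ : absoluteGaloisGroup K,
        (∀ X : geomTorsion W ((2 ^ (n + 1) : ℕ) : ℤ),
          (c₀ * absGaloisRestrict ℚ K ρ) • (c₀ * absGaloisRestrict ℚ K ρ) • X = X) ∧
        (∀ ζ : AlgebraicClosure ℚ, ζ ^ (2 ^ (n + 1)) = 1 → (c₀ * absGaloisRestrict ℚ K ρ) • ζ = ζ⁻¹) ∧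
        (∃ P : geomTorsion W ((2 ^ (n + 1) : ℕ) : ℤ),
          (2 : ℤ) ^ n • (P + (c₀ * absGaloisRestrict ℚ K ρ) • P) ≠ 0) ∧
        (∀ (k : ℕ) (X : geomTorsion W ((2 ^ (n + 1) : ℕ) : ℤ)), (2 : ℤ) ^ k • X = 0 →
            (c₀ * absGaloisRestrict ℚ K ρ) • X = X →
            ∃ Y : geomTorsion W ((2 ^ (n + 1) : ℕ) : ℤ),
              (2 : ℤ) ^ k • Y = 0 ∧ X = Y + (c₀ * absGaloisRestrict ℚ K ρ) • Y) ∧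
        ∃ ℓ : ℕ, b < ℓ ∧ ℓ.Prime ∧ ¬ ℓ ∣ W.conductorNorm ℤ ∧ ¬ ((ℓ : ℤ) ∣ NumberField.discr K) ∧ ℓ ≠ 2 ∧
          (Ideal.span {(ℓ : 𝓞 K)}).IsPrime ∧
          (∃ (v : HeightOneSpectrum (𝓞 ℚ)) (𝔓 : Ideal (absIntegers (𝓞 ℚ) ℚ)) (h : absoluteGaloisGroup ℚ),
            (ℓ : 𝓞 ℚ) ∈ v.asIdeal ∧ 𝔓 ∈ v.primesAbove ∧ IsArithFrobAt (𝓞 ℚ) h 𝔓 ∧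
            (∀ P : geomTorsion W ((2 ^ (n + 1) : ℕ) : ℤ), h • P = (c₀ * absGaloisRestrict ℚ K ρ) • P) ∧
            ∀ (e : K →ₐ[ℚ] AlgebraicClosure ℚ) (x : K), h • e x = c₀ • e x) ∧
          2 ^ (n + 1) ∣ ℓ + 1 ∧ ((2 : ℤ) ^ (n + 1)) ∣ W.frobeniusTrace ℓ ∧
          ∀ i, ∀ v : HeightOneSpectrum (𝓞 K), (ℓ : 𝓞 K) ∈ v.asIdeal →
            (((2 : ℤ) ^ Nv i) • cs i ∈
                (W.baseChange K).torsionLocalKer (v.adicCompletion K) ((2 ^ (n + 1) : ℕ) : ℤ) ∧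
              (Nv i ≠ 0 → ((2 : ℤ) ^ (Nv i - 1)) • cs i ∉
                (W.baseChange K).torsionLocalKer (v.adicCompletion K) ((2 ^ (n + 1) : ℕ) : ℤ))) := by
  intro W _ _ _ K _ _ hK hodd hH hsurj n c₀ hc₀ c hc r cs π hπ hcs e he hind hres Nv hNe heM hNπ b
  have h2 : W.HasSurjectiveModNGaloisRep 2 := by simpa using hsurj 1 one_pos
  have hM : W.HasSurjectiveModNGaloisRep ((2 ^ (n + 1) : ℕ) : ℤ) := by
    have := hsurj (n + 1) (Nat.succ_pos n); exact_mod_cast this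
  exact OffBigImageOddLocalAtTwo.Engine.exists_regular_kolyvaginPrime_of_heegner
    (N := W.conductorNorm ℤ) Automorphic.chebotarev_artinRep_of_galoisSide hK hodd hH n h2 hM hc₀ hc
    cs hπ hcs e he hind hres Nv hNe heM hNπ b

end Summit.BirchSwinnertonDyer.BirchSwinnertonDyer.Theorems.GenusRegularSupply

end
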